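import Mathlib
import Literature.NumberTheory.LFunctions.NumHelpers
import HarnessLib

/-!
# SCHEDULE LINK 59 — the once-only real-analysis link facts ((E), (Q), (A1), (Lg), (X), (R), (S), (W)) that turn the rational
  per-hop schedule certificates (theory-1 numT59 `Schedule59C2L/C3L`, `rowMM.OK`) into the real scalar hypotheses of
  `HopTube.tubeStepNearBehindR54_of_schedule` (helper for the K_A♭ parent item stmt-NavierStokesRegularity-22987
  `FlatGapCertificatesV2`, child 2A `GradedAdiabaticWakeA` of route TaoLadderRungTwoFlat; cell harvest/h2-tao-ladder,
  theory-1 g47 numT59L / LADDER §59.8)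

PROVENANCE (p1 g23): theory-1 g47's image of record numT59/ScheduleLink59.lean sha16 4332b1190dd6ee9c (230 l., farm `lean check`
rc 0 · 0 sorry · 0 warnings; Mathlib only), landed with declarations BYTE-IDENTICAL (+ lint docstrings where the image had none) under
the tree namespace `Summit.NavierStokesRegularity.NavierStokesRegularity.Theorems.Schedule59.Link` (the image's `TaoLadder.Schedule59.Link`).
The image's module docstring follows verbatim.

# numT59 — analytic LINK FACTS for the schedule certificates `Schedule59C2L.lean` / `Schedule59C3L.lean`
(cell file, theory-1 g47, 2026-08-29; Mathlib only, no sorry).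

These are the once-only real-analysis facts (E), (Q), (A1), (Lg), (X), (R), (S), (W) named in the certificate files' docstrings,
which turn the rational inequalities `rowMM.OK` into the real hypotheses of `HopTube.tubeStepNearBehindR54_of_schedule`.
MODEL-lattice bookkeeping only; nothing here is about the Navier–Stokes equations.
-/

set_option linter.dupNamespace false

namespace Summit.NavierStokesRegularity.NavierStokesRegularity.Theorems.Schedule59.Link

export Literature.NumberTheory.LFunctions.VdC.Num (sqrt_le_of_le_sq le_sqrt_of_sq_le)

/-! ## (S) square roots against rational enclosures -/

/-! ## (E) the constants `exp (1/2)`, `sinh (1/2)`, `exp 1`, `exp (-13)` -/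

/-- Link fact `exp_half_sq` (lint docstring added at landing; see the module docstring for its role). [folklore (elementary real analysis); cell LADDER §59.8 (numT59L)] -/
theorem exp_half_sq : Real.exp (1 / 2) ^ 2 = Real.exp 1 := by
  rw [← Real.exp_nat_mul]; norm_num

/-- `exp (1/2) ≤ c` as soon as `0 ≤ c` and `2.7182818286 ≤ c²` (uses `Real.exp_one_lt_d9`). -/
theorem exp_half_le {c : ℝ} (hc : 0 ≤ c) (h : (27182818286 : ℝ) / 10000000000 ≤ c ^ 2) :
    Real.exp (1 / 2) ≤ c := by
  have h1 : Real.exp 1 < 2.7182818286 := Real.exp_one_lt_d9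
  have h1' : Real.exp 1 < (27182818286 : ℝ) / 10000000000 := by
    have : (2.7182818286 : ℝ) = (27182818286 : ℝ) / 10000000000 := by norm_num
    linarith [this]
  by_contra hlt
  push Not at hlt
  have hsq : c ^ 2 < Real.exp (1 / 2) ^ 2 := by
    have := mul_self_lt_mul_self hc hlt
    nlinarith [this]
  rw [exp_half_sq] at hsq
  linarith

/-- `sinh (1/2) ≤ s` from an upper enclosure `c` of `exp (1/2)` with `(c - 1/c)/2 ≤ s`. -/
theorem sinh_half_le {c s : ℝ} (hce : Real.exp (1 / 2) ≤ c) (hs : (c - 1 / c) / 2 ≤ s) :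
    Real.sinh (1 / 2) ≤ s := by
  rw [Real.sinh_eq]
  have hpos : 0 < Real.exp (1 / 2) := Real.exp_pos _
  have hinv : 1 / c ≤ Real.exp (-(1 / 2)) := by
    rw [Real.exp_neg, ← one_div]
    exact one_div_le_one_div_of_le hpos hce
  linarith

/-- `exp 1 ≤ 2.7182818286`. -/
theorem exp_one_le : Real.exp 1 ≤ (27182818286 : ℝ) / 10000000000 := by
  have h1 : Real.exp 1 < 2.7182818286 := Real.exp_one_lt_d9
  have : (2.7182818286 : ℝ) = (27182818286 : ℝ) / 10000000000 := by norm_num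
  linarith

/-- `exp (-13) ≤ d` as soon as `0 ≤ d` and `1 ≤ d · 2.7182818283¹³` (uses `Real.exp_one_gt_d9`). -/
theorem exp_neg_thirteen_le {d : ℝ} (hd : 0 ≤ d) (h : 1 ≤ d * ((27182818283 : ℝ) / 10000000000) ^ 13) :
    Real.exp (-13) ≤ d := by
  have hlo : (2.7182818283 : ℝ) < Real.exp 1 := Real.exp_one_gt_d9
  have hlo' : (27182818283 : ℝ) / 10000000000 < Real.exp 1 := by
    have : (2.7182818283 : ℝ) = (27182818283 : ℝ) / 10000000000 := by norm_num
    linarith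
  have h13 : Real.exp 13 = Real.exp 1 ^ 13 := by
    rw [← Real.exp_nat_mul]; norm_num
  have hpow : ((27182818283 : ℝ) / 10000000000) ^ 13 < Real.exp 13 := by
    rw [h13]
    exact pow_lt_pow_left₀ hlo' (by norm_num) (by norm_num)
  have hprod : Real.exp (-13) * Real.exp 13 = 1 := by
    rw [← Real.exp_add]; norm_num
  have hP : 0 < Real.exp (-13) := Real.exp_pos _
  have hE : 0 < Real.exp 13 := Real.exp_pos _
  have h2 : 1 ≤ d * Real.exp 13 := by
    have : d * ((27182818283 : ℝ) / 10000000000) ^ 13 ≤ d * Real.exp 13 :=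
      mul_le_mul_of_nonneg_left hpow.le hd
    linarith
  nlinarith

/-! ## (Q), (A1), (W) the co-moving budget on the good-time window -/

/-- (Q): `exp (-x) ≤ 1/(1 + x + x²/2)` for `x ≥ 0` (`Real.quadratic_le_exp_of_nonneg`). -/
theorem exp_neg_le_U {x : ℝ} (hx : 0 ≤ x) : Real.exp (-x) ≤ 1 / (1 + x + x ^ 2 / 2) := by
  have hq : 1 + x + x ^ 2 / 2 ≤ Real.exp x := Real.quadratic_le_exp_of_nonneg hx
  have hqpos : 0 < 1 + x + x ^ 2 / 2 := by positivity
  rw [Real.exp_neg, ← one_div]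
  exact one_div_le_one_div_of_le hqpos hq

/-- (A1): `(1 - exp (-(μ t)))/μ ≤ t` for `μ > 0` (`Real.add_one_le_exp`). -/
theorem one_sub_exp_neg_div_le {μ t : ℝ} (hμ : 0 < μ) : (1 - Real.exp (-(μ * t))) / μ ≤ t := by
  have h := Real.add_one_le_exp (-(μ * t))
  have : 1 - Real.exp (-(μ * t)) ≤ t * μ := by linarith
  calc (1 - Real.exp (-(μ * t))) / μ ≤ (t * μ) / μ := by
        exact div_le_div_of_nonneg_right this hμ.le
    _ = t := by field_simp

/-- (W): on the window `tlo ≤ t ≤ c0` (with `0 ≤ tlo`, `0 < μ`, `V₀, E ≥ 0`):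
`exp(-μ t) V₀ + E (1 - exp(-μ t))/μ ≤ V₀ · 1/(1 + μ tlo + (μ tlo)²/2) + E c0`. -/
theorem window_budget_le {μ t tlo c0 V₀ E : ℝ} (hμ : 0 < μ) (hV : 0 ≤ V₀) (hE : 0 ≤ E)
    (htlo : 0 ≤ tlo) (h1 : tlo ≤ t) (h2 : t ≤ c0) :
    Real.exp (-(μ * t)) * V₀ + E * (1 - Real.exp (-(μ * t))) / μ
      ≤ V₀ * (1 / (1 + μ * tlo + (μ * tlo) ^ 2 / 2)) + E * c0 := by
  have hx : 0 ≤ μ * tlo := mul_nonneg hμ.le htlo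
  have hmono : Real.exp (-(μ * t)) ≤ Real.exp (-(μ * tlo)) := by
    apply Real.exp_le_exp.mpr
    have : μ * tlo ≤ μ * t := mul_le_mul_of_nonneg_left h1 hμ.le
    linarith
  have hU : Real.exp (-(μ * tlo)) ≤ 1 / (1 + μ * tlo + (μ * tlo) ^ 2 / 2) := exp_neg_le_U hx
  have hA : (1 - Real.exp (-(μ * t))) / μ ≤ t := one_sub_exp_neg_div_le hμ
  have hterm1 : Real.exp (-(μ * t)) * V₀ ≤ V₀ * (1 / (1 + μ * tlo + (μ * tlo) ^ 2 / 2)) := by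
    have := mul_le_mul_of_nonneg_right (hmono.trans hU) hV
    linarith [this]
  have hterm2 : E * (1 - Real.exp (-(μ * t))) / μ ≤ E * c0 := by
    have : E * ((1 - Real.exp (-(μ * t))) / μ) ≤ E * c0 :=
      mul_le_mul_of_nonneg_left (hA.trans h2) hE
    calc E * (1 - Real.exp (-(μ * t))) / μ = E * ((1 - Real.exp (-(μ * t))) / μ) := by ring
      _ ≤ E * c0 := this
  linarith

/-! ## (Lg) and (X): `θ' = 2 log (1+ε₀)` at `θ_b' = 1` -/

/-- (Lg): `ε₀/(1+ε₀) ≤ log (1+ε₀)` (`Real.one_sub_inv_le_log_of_pos`), hence `2ε₀/(1+ε₀) ≤ 2 log(1+ε₀) = θ'`. -/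
theorem thetaPrime_lower {ε₀ : ℝ} (hε : 0 < ε₀) :
    2 * ε₀ / (1 + ε₀) ≤ 2 * Real.log (1 + ε₀) := by
  have hpos : 0 < 1 + ε₀ := by linarith
  have h := Real.one_sub_inv_le_log_of_pos hpos
  have hid : 1 - (1 + ε₀)⁻¹ = ε₀ / (1 + ε₀) := by
    field_simp
    ring
  rw [hid] at h
  have : 2 * ε₀ / (1 + ε₀) = 2 * (ε₀ / (1 + ε₀)) := by ring
  rw [this]
  linarith

/-- (X1): `exp (θ'/2) = 1 + ε₀` for `θ' = 2 log(1+ε₀)`. -/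
theorem exp_half_thetaPrime {ε₀ : ℝ} (hε : 0 < ε₀) :
    Real.exp (2 * Real.log (1 + ε₀) / 2) = 1 + ε₀ := by
  have hpos : 0 < 1 + ε₀ := by linarith
  rw [show 2 * Real.log (1 + ε₀) / 2 = Real.log (1 + ε₀) by ring]
  exact Real.exp_log hpos

/-- (X2): `sinh (θ'/2) = ε₀(2+ε₀)/(2(1+ε₀))`. -/
theorem sinh_half_thetaPrime {ε₀ : ℝ} (hε : 0 < ε₀) :
    Real.sinh (2 * Real.log (1 + ε₀) / 2) = ε₀ * (2 + ε₀) / (2 * (1 + ε₀)) := by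
  have hpos : 0 < 1 + ε₀ := by linarith
  rw [show 2 * Real.log (1 + ε₀) / 2 = Real.log (1 + ε₀) by ring, Real.sinh_eq, Real.exp_neg,
    Real.exp_log hpos]
  field_simp
  ring

/-- (X3): `1 - exp (-θ') = 1 - ((1+ε₀)²)⁻¹`. -/
theorem one_sub_exp_neg_thetaPrime {ε₀ : ℝ} (hε : 0 < ε₀) :
    1 - Real.exp (-(2 * Real.log (1 + ε₀))) = 1 - ((1 + ε₀) ^ 2)⁻¹ := by
  have hpos : 0 < 1 + ε₀ := by linarith
  rw [Real.exp_neg, show 2 * Real.log (1 + ε₀) = (2 : ℕ) * Real.log (1 + ε₀) by norm_num,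
    Real.exp_nat_mul, Real.exp_log hpos]

/-- (X4): the behind feed factor `exp (θ'/2) · exp (θ'(D-K)/2) = (1+ε₀)^(1+(D-K))` for natural `D - K`. -/
theorem feed_factor_eq {ε₀ : ℝ} (hε : 0 < ε₀) (dK : ℕ) :
    Real.exp (2 * Real.log (1 + ε₀) / 2) * Real.exp (2 * Real.log (1 + ε₀) * dK / 2)
      = (1 + ε₀) ^ (1 + dK) := by
  have hpos : 0 < 1 + ε₀ := by linarith
  rw [show 2 * Real.log (1 + ε₀) / 2 = Real.log (1 + ε₀) by ring,
    show 2 * Real.log (1 + ε₀) * dK / 2 = (dK : ℕ) * Real.log (1 + ε₀) by ring,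
    Real.exp_nat_mul, Real.exp_log hpos]
  ring

/-- (X5): `1/sqrt(1 - exp(-θ')) ≤ ι` from the rational check `1 ≤ ι² (1 - ((1+ε₀)²)⁻¹)`, `0 ≤ ι`. -/
theorem inv_sqrt_le {ε₀ ι : ℝ} (hε : 0 < ε₀) (hι : 0 ≤ ι)
    (h : 1 ≤ ι ^ 2 * (1 - 1 / (1 + ε₀) ^ 2)) :
    1 / Real.sqrt (1 - Real.exp (-(2 * Real.log (1 + ε₀)))) ≤ ι := by
  rw [one_sub_exp_neg_thetaPrime hε]
  have hpos : 0 < 1 + ε₀ := by linarith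
  have hy : 0 < 1 - ((1 + ε₀) ^ 2)⁻¹ := by
    have hsq1 : 1 < (1 + ε₀) ^ 2 := by nlinarith
    have hrew : 1 - ((1 + ε₀) ^ 2)⁻¹ = ((1 + ε₀) ^ 2 - 1) / (1 + ε₀) ^ 2 := by
      field_simp
    rw [hrew]
    apply div_pos <;> nlinarith
  have hy' : 1 - 1 / (1 + ε₀) ^ 2 = 1 - ((1 + ε₀) ^ 2)⁻¹ := by rw [one_div]
  rw [hy'] at h
  have hs : 0 < Real.sqrt (1 - ((1 + ε₀) ^ 2)⁻¹) := Real.sqrt_pos.mpr hy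
  rw [div_le_iff₀ hs]
  -- 1 ≤ ι * sqrt y  ⇐  1 ≤ ι² y
  have hιs : 0 ≤ ι * Real.sqrt (1 - ((1 + ε₀) ^ 2)⁻¹) := mul_nonneg hι hs.le
  have hsq : (ι * Real.sqrt (1 - ((1 + ε₀) ^ 2)⁻¹)) ^ 2 = ι ^ 2 * (1 - ((1 + ε₀) ^ 2)⁻¹) := by
    rw [mul_pow, Real.sq_sqrt hy.le]
  nlinarith [hsq, hιs]

/-! ## (R) the ratio floor: `Q ≤ ((1+ε₀)^(-θ₀))²` from `Q^k (1+ε₀) ≤ 1`, `θ₀ = 1/(2k)` -/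

/-- Link fact `ratio_sq_ge` (lint docstring added at landing; see the module docstring for its role). [folklore (elementary real analysis); cell LADDER §59.8 (numT59L)] -/
theorem ratio_sq_ge {ε₀ Q : ℝ} {k : ℕ} (hk : k ≠ 0) (hε : 0 < ε₀) (hQ : 0 ≤ Q)
    (h : Q ^ k * (1 + ε₀) ≤ 1) :
    Q ≤ ((1 + ε₀) ^ (-(1 / (2 * (k : ℝ))))) ^ 2 := by
  have hb : 0 < 1 + ε₀ := by linarith
  have hk' : (k : ℝ) ≠ 0 := Nat.cast_ne_zero.mpr hk
  have hQk : Q ^ k ≤ (1 + ε₀)⁻¹ := by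
    rw [← one_div, le_div_iff₀ hb]
    exact h
  have hQeq : (Q ^ k) ^ ((k : ℝ)⁻¹) = Q := Real.pow_rpow_inv_natCast hQ hk
  have hmono : (Q ^ k) ^ ((k : ℝ)⁻¹) ≤ ((1 + ε₀)⁻¹) ^ ((k : ℝ)⁻¹) :=
    Real.rpow_le_rpow (pow_nonneg hQ k) hQk (by positivity)
  have hl : ((1 + ε₀)⁻¹) ^ ((k : ℝ)⁻¹) = (1 + ε₀) ^ (-((k : ℝ)⁻¹)) := by
    rw [Real.inv_rpow hb.le, ← Real.rpow_neg hb.le]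
  have hr : ((1 + ε₀) ^ (-(1 / (2 * (k : ℝ))))) ^ 2 = (1 + ε₀) ^ (-((k : ℝ)⁻¹)) := by
    rw [← Real.rpow_natCast ((1 + ε₀) ^ (-(1 / (2 * (k : ℝ))))) 2, ← Real.rpow_mul hb.le]
    congr 1
    field_simp
    try ring
  calc Q = (Q ^ k) ^ ((k : ℝ)⁻¹) := hQeq.symm
    _ ≤ ((1 + ε₀)⁻¹) ^ ((k : ℝ)⁻¹) := hmono
    _ = (1 + ε₀) ^ (-((k : ℝ)⁻¹)) := hl
    _ = ((1 + ε₀) ^ (-(1 / (2 * (k : ℝ))))) ^ 2 := hr.symm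

/-- (R) at θ₀ = 1/4 (k = 2) and θ₀ = 1/8 (k = 4), in the shape `((1 + ε₀) ^ (-θ₀)) ^ 2` of `hbudgetN/B`. -/
theorem ratio_sq_ge_quarter {ε₀ Q : ℝ} (hε : 0 < ε₀) (hQ : 0 ≤ Q) (h : Q ^ 2 * (1 + ε₀) ≤ 1) :
    Q ≤ ((1 + ε₀) ^ (-(1 / 4 : ℝ))) ^ 2 := by
  have := ratio_sq_ge (k := 2) (by norm_num) hε hQ h
  norm_num at this
  exact this

/-- Link fact `ratio_sq_ge_eighth` (lint docstring added at landing; see the module docstring for its role). [folklore (elementary real analysis); cell LADDER §59.8 (numT59L)] -/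
theorem ratio_sq_ge_eighth {ε₀ Q : ℝ} (hε : 0 < ε₀) (hQ : 0 ≤ Q) (h : Q ^ 4 * (1 + ε₀) ≤ 1) :
    Q ≤ ((1 + ε₀) ^ (-(1 / 8 : ℝ))) ^ 2 := by
  have := ratio_sq_ge (k := 4) (by norm_num) hε hQ h
  norm_num at this
  exact this

end Summit.NavierStokesRegularity.NavierStokesRegularity.Theorems.Schedule59.Link
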